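import Summits.Ventures.PercRepro.MSTightProduct

/-!
# The converse: a product of a down-set and an up-set is tight with down-closed differences

`MSTightProduct.lean` shows that a tight family with a down-closed difference family is `L ⊻ U`
with `L` a down-set of subsets of `N` and `U` an up-set within `M`, `N` and `M` disjoint. This
file proves the converse, so that the two properties characterise each other:

* `diffs_sups_eq`: `(L ⊻ U) \\ (L ⊻ U) = L ⊻ complWithin M U` — the differences of a product are
  the products of the differences, a down-set has itself as difference family
  (`diffs_eq_self_of_isDownSet`) and an up-set within `M` has the complements of its members
  (`diffs_eq_complWithin_of_isUpSetWithin`);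
* `tight_sups`: `L ⊻ U` is tight (both factors nonempty), and
* `isDownSet_diffs_sups`: its difference family is a down-set.

Hence (`tight_and_isDownSet_iff`): `Tight F ∧ IsDownSet (F \\ F)` iff `F` is such a product —
the equality cases of Marica–Schönheim in the down-closed case (paper: Theorem S, proofs §17).
-/

namespace PercRepro.MSTight

open Finset
open scoped FinsetFamily

variable {α : Type*} [DecidableEq α]

/-- A nonempty down-set is its own difference family. -/
theorem diffs_eq_self_of_isDownSet {L : Finset (Finset α)} (hL : IsDownSet L) (hne : L.Nonempty) :
    L \\ L = L := by
  ext E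
  constructor
  · intro hE
    obtain ⟨X, hX, _, _, rfl⟩ := mem_diffs.1 hE
    exact hL X hX _ sdiff_subset
  · intro hE
    obtain ⟨X, hX⟩ := hne
    have h0 : (∅ : Finset α) ∈ L := hL X hX ∅ (empty_subset _)
    exact mem_diffs.2 ⟨E, hE, ∅, h0, by simp⟩

/-- The difference family of a nonempty up-set within `M` is the family of complements (within
`M`) of its members. -/
theorem diffs_eq_complWithin_of_isUpSetWithin {M : Finset α} {U : Finset (Finset α)}
    (hU : IsUpSetWithin M U) (hUM : ∀ Y ∈ U, Y ⊆ M) (hne : U.Nonempty) :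
    U \\ U = complWithin M U := by
  obtain ⟨Y₀, hY₀⟩ := hne
  have hM : M ∈ U := hU Y₀ hY₀ M le_rfl (hUM Y₀ hY₀)
  ext E
  constructor
  · intro hE
    obtain ⟨Y, hY, Y', hY', rfl⟩ := mem_diffs.1 hE
    -- `Y \ Y' = M \ ((M \ Y) ∪ Y')` and `(M \ Y) ∪ Y' ⊇ Y'` is a member
    have hmem : (M \ Y) ∪ Y' ∈ U :=
      hU Y' hY' _ (union_subset sdiff_subset (hUM Y' hY')) subset_union_right
    refine mem_complWithin.2 ⟨_, hmem, ?_⟩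
    ext s
    simp only [mem_sdiff, mem_union, not_or, not_and, not_not]
    constructor
    · rintro ⟨hsM, h1, h2⟩
      exact ⟨h1 hsM, h2⟩
    · rintro ⟨hsY, hsY'⟩
      exact ⟨hUM Y hY hsY, fun _ => hsY, hsY'⟩
  · intro hE
    obtain ⟨Y, hY, rfl⟩ := mem_complWithin.1 hE
    exact mem_diffs.2 ⟨M, hM, Y, hY, rfl⟩

/-- `(X ∪ Y) \ (X' ∪ Y') = (X \ X') ∪ (Y \ Y')` when the `X`s live in `N` and the `Y`s in `M`,
`N` and `M` disjoint. -/
theorem sdiff_union_union_eq {X X' Y Y' N M : Finset α} (hNM : Disjoint N M) (hX : X ⊆ N)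
    (hX' : X' ⊆ N) (hY : Y ⊆ M) (hY' : Y' ⊆ M) :
    (X ∪ Y) \ (X' ∪ Y') = (X \ X') ∪ (Y \ Y') := by
  ext s
  simp only [mem_sdiff, mem_union, not_or]
  constructor
  · rintro ⟨hs | hs, hsX', hsY'⟩
    · exact Or.inl ⟨hs, hsX'⟩
    · exact Or.inr ⟨hs, hsY'⟩
  · rintro (⟨hs, hsX'⟩ | ⟨hs, hsY'⟩)
    · exact ⟨Or.inl hs, hsX', fun h => Finset.disjoint_left.1 hNM (hX hs) (hY' h)⟩
    · exact ⟨Or.inr hs, fun h => Finset.disjoint_left.1 hNM (hX' h) (hY hs), hsY'⟩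

/-- The differences of a product on disjoint supports are the products of the differences. -/
theorem diffs_sups_of_disjoint {S T : Finset (Finset α)} {N M : Finset α} (hNM : Disjoint N M)
    (hS : ∀ X ∈ S, X ⊆ N) (hT : ∀ Y ∈ T, Y ⊆ M) :
    (S ⊻ T) \\ (S ⊻ T) = (S \\ S) ⊻ (T \\ T) := by
  ext E
  constructor
  · intro hE
    obtain ⟨Z, hZ, Z', hZ', rfl⟩ := mem_diffs.1 hE
    obtain ⟨X, hX, Y, hY, rfl⟩ := mem_sups.1 hZ
    obtain ⟨X', hX', Y', hY', rfl⟩ := mem_sups.1 hZ'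
    refine mem_sups.2 ⟨X \ X', mem_diffs.2 ⟨X, hX, X', hX', rfl⟩,
      Y \ Y', mem_diffs.2 ⟨Y, hY, Y', hY', rfl⟩, ?_⟩
    simp only [sup_eq_union]
    exact (sdiff_union_union_eq hNM (hS X hX) (hS X' hX') (hT Y hY) (hT Y' hY')).symm
  · intro hE
    obtain ⟨DX, hDX, DY, hDY, rfl⟩ := mem_sups.1 hE
    obtain ⟨X, hX, X', hX', rfl⟩ := mem_diffs.1 hDX
    obtain ⟨Y, hY, Y', hY', rfl⟩ := mem_diffs.1 hDY
    refine mem_diffs.2 ⟨X ⊔ Y, mem_sups.2 ⟨X, hX, Y, hY, rfl⟩, X' ⊔ Y',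
      mem_sups.2 ⟨X', hX', Y', hY', rfl⟩, ?_⟩
    simp only [sup_eq_union]
    exact sdiff_union_union_eq hNM (hS X hX) (hS X' hX') (hT Y hY) (hT Y' hY')

/-- The differences of a product of a down-set on `N` and an up-set within `M`. -/
theorem diffs_sups_eq {L U : Finset (Finset α)} {N M : Finset α} (hNM : Disjoint N M)
    (hL : IsDownSet L) (hLN : ∀ X ∈ L, X ⊆ N) (hLne : L.Nonempty) (hU : IsUpSetWithin M U)
    (hUM : ∀ Y ∈ U, Y ⊆ M) (hUne : U.Nonempty) :
    (L ⊻ U) \\ (L ⊻ U) = L ⊻ complWithin M U := by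
  rw [diffs_sups_of_disjoint hNM hLN hUM, diffs_eq_self_of_isDownSet hL hLne,
    diffs_eq_complWithin_of_isUpSetWithin hU hUM hUne]

/-- **Products are tight.** -/
theorem tight_sups {L U : Finset (Finset α)} {N M : Finset α} (hNM : Disjoint N M)
    (hL : IsDownSet L) (hLN : ∀ X ∈ L, X ⊆ N) (hLne : L.Nonempty) (hU : IsUpSetWithin M U)
    (hUM : ∀ Y ∈ U, Y ⊆ M) (hUne : U.Nonempty) : Tight (L ⊻ U) := by
  show ((L ⊻ U) \\ (L ⊻ U)).card = (L ⊻ U).card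
  rw [diffs_sups_eq hNM hL hLN hLne hU hUM hUne, card_sups_of_disjoint hNM hLN hUM,
    card_sups_of_disjoint hNM hLN (fun Y hY => by
      obtain ⟨Y₀, _, rfl⟩ := mem_complWithin.1 hY
      exact sdiff_subset)]
  congr 1
  exact card_image_of_injOn fun Y hY Y' hY' h => by
    have hY₁ : Y ⊆ M := hUM Y (mem_coe.1 hY)
    have hY₂ : Y' ⊆ M := hUM Y' (mem_coe.1 hY')
    have : M \ (M \ Y) = M \ (M \ Y') := by rw [h]
    rwa [Finset.sdiff_sdiff_eq_self hY₁, Finset.sdiff_sdiff_eq_self hY₂] at this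

/-- The complements within `M` of an up-set within `M` form a down-set. -/
theorem isDownSet_complWithin_of_isUpSetWithin {M : Finset α} {U : Finset (Finset α)}
    (hU : IsUpSetWithin M U) (hUM : ∀ Y ∈ U, Y ⊆ M) : IsDownSet (complWithin M U) := by
  intro Y' hY' Y'' hY''
  obtain ⟨Y, hY, rfl⟩ := mem_complWithin.1 hY'
  have hsub : Y ⊆ M \ Y'' := fun s hs =>
    mem_sdiff.2 ⟨hUM Y hY hs, fun h => (mem_sdiff.1 (hY'' h)).2 hs⟩
  have hmem : M \ Y'' ∈ U := hU Y hY _ sdiff_subset hsub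
  exact mem_complWithin.2 ⟨M \ Y'', hmem, Finset.sdiff_sdiff_eq_self (hY''.trans sdiff_subset)⟩

/-- The difference family of a product of a down-set and an up-set within `M` is a down-set. -/
theorem isDownSet_diffs_sups {L U : Finset (Finset α)} {N M : Finset α} (hNM : Disjoint N M)
    (hL : IsDownSet L) (hLN : ∀ X ∈ L, X ⊆ N) (hLne : L.Nonempty) (hU : IsUpSetWithin M U)
    (hUM : ∀ Y ∈ U, Y ⊆ M) (hUne : U.Nonempty) : IsDownSet ((L ⊻ U) \\ (L ⊻ U)) := by
  rw [diffs_sups_eq hNM hL hLN hLne hU hUM hUne]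
  intro Z hZ Z' hZ'
  obtain ⟨X, hX, Y, hY, rfl⟩ := mem_sups.1 hZ
  rw [sup_eq_union] at hZ'
  have hX' : Z' ∩ N ∈ L := by
    refine hL X hX _ fun s hs => ?_
    obtain ⟨hs1, hs2⟩ := mem_inter.1 hs
    rcases mem_union.1 (hZ' hs1) with h | h
    · exact h
    · exact absurd hs2 (Finset.disjoint_right.1 hNM
        (sdiff_subset ((mem_complWithin.1 hY).choose_spec.2 ▸ h)))
  have hY' : Z' ∩ M ∈ complWithin M U := by
    refine isDownSet_complWithin_of_isUpSetWithin hU hUM Y hY _ fun s hs => ?_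
    obtain ⟨hs1, hs2⟩ := mem_inter.1 hs
    rcases mem_union.1 (hZ' hs1) with h | h
    · exact absurd hs2 (Finset.disjoint_left.1 hNM (hLN X hX h))
    · exact h
  refine mem_sups.2 ⟨_, hX', _, hY', ?_⟩
  rw [sup_eq_union]
  ext s
  simp only [mem_union, mem_inter]
  constructor
  · rintro (⟨hs, _⟩ | ⟨hs, _⟩) <;> exact hs
  · intro hs
    rcases mem_union.1 (hZ' hs) with h | h
    · exact Or.inl ⟨hs, hLN X hX h⟩
    · obtain ⟨Y₀, _, hY₀⟩ := mem_complWithin.1 hY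
      exact Or.inr ⟨hs, (hY₀ ▸ sdiff_subset) h⟩

/-- **Characterisation (down-closed case).** `F` is tight with a down-closed difference family
iff `F` is the product of a nonempty down-set `L` of subsets of some `N ⊆ u` and a nonempty up-set
`U` within `M = u \ N`. -/
theorem tight_and_isDownSet_iff {u : Finset α} {F : Finset (Finset α)} (hFu : ∀ A ∈ F, A ⊆ u)
    (hne : F.Nonempty) :
    Tight F ∧ IsDownSet (F \\ F) ↔
      ∃ M ⊆ u, ∃ L U : Finset (Finset α), IsDownSet L ∧ (∀ X ∈ L, X ⊆ u \ M) ∧ L.Nonempty ∧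
        IsUpSetWithin M U ∧ (∀ Y ∈ U, Y ⊆ M) ∧ U.Nonempty ∧ F = L ⊻ U := by
  constructor
  · rintro ⟨hF, hD⟩
    obtain ⟨M, hMu, L, U, hL, hLN, hU, hUM, hFeq, _⟩ :=
      exists_downSet_upSet_of_tight_of_isDownSet hF hD hFu
    obtain ⟨A, hA⟩ := hne
    have hA' := hA
    rw [hFeq] at hA'
    obtain ⟨X, hX, Y, hY, _⟩ := mem_sups.1 hA'
    exact ⟨M, hMu, L, U, hL, hLN, ⟨X, hX⟩, hU, hUM, ⟨Y, hY⟩, hFeq⟩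
  · rintro ⟨M, _, L, U, hL, hLN, hLne, hU, hUM, hUne, rfl⟩
    have hNM : Disjoint (u \ M) M := Finset.sdiff_disjoint
    exact ⟨tight_sups hNM hL hLN hLne hU hUM hUne, isDownSet_diffs_sups hNM hL hLN hLne hU hUM hUne⟩

end PercRepro.MSTight
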